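import Summits.Ventures.HodgeRepro2.T5SU11JacobiPhaseSecondOrder
import Summits.Ventures.HodgeRepro2.T5SU11JacobiPhaseLawRateOutside

/-!
# The rate of `(k − 2) m̂_k(λ) → 2π`: `m̂_k(λ) = (2π/(k − 2))(1 − c/(k − 2) + O(1/(k − 2)²))`

`T5SU11JacobiPhaseLawAsymptotic` proves `(k − 2) m̂_k(λ) → 2π` for every `λ`. With the Laplace form
`m̂_k(λ) = 2π N(0)`, `N(0) = ∫_0^∞ e^{−(k−2)s} Φ_λ(s) ds`, and the bounds on `Φ_λ` in the phase
(`T5SU11JacobiPhaseLipschitz`, `T5SU11JacobiPhaseSecondOrder`, `T5SU11JacobiPhaseLawRateOutside`), this is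
quantitative, with `r = k − 2`:

* `0 ≤ λ ≤ 2`, `c = λ(2 − λ)/2`: **`1 − c/r ≤ r m̂_k(λ)/(2π) ≤ 1`** (`weight_ratio_le_one`, `one_sub_le_weight_ratio`),
  and to second order **`1 − c/r ≤ r m̂_k(λ)/(2π) ≤ 1 − c/r + c²/r²`** (`weight_ratio_le_second_order`): the
  transform is `2π/r · (1 − c/r + O(1/r²))` — the first correction `−c/(k − 2)` of the Jensen range is exactly the
  Casimir-type constant `λ(2 − λ)/2`, and `c` is the sharp coefficient (`r(1 − r m̂_k(λ)/(2π)) → c`,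
  `tendsto_mul_one_sub_weight_ratio`);
* `λ ≥ 2` or `λ ≤ 0`, `c' = λ(λ − 2)/2 < r`: **`1 ≤ r m̂_k(λ)/(2π) ≤ r/(r − c')`** (`one_le_weight_ratio_of_two_le`,
  `weight_ratio_le_of_two_le`, `weight_ratio_le_of_nonpos`), i.e. `0 ≤ r m̂_k(λ)/(2π) − 1 ≤ c'/(r − c')`.

At `λ = 0` (`c = 0`) the transform is exactly `2π/(k − 2)` (`T5SU11JacobiTransform`). Nothing is claimed about (N).

Blind lane: Mathlib + the HodgeRepro2 prefix only; no sorry; axioms ⊆ {propext, Classical.choice,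
Quot.sound}.
-/

namespace Summit.Ventures.HodgeRepro2.T5SU11JacobiWeightRate

open MeasureTheory MeasureTheory.Measure Metric Set Filter Topology
open T5SU11Unimodular T5SU11Fibration T5SU11Cartan T5SU11OneParameter T5SU11CartanProjection T5HaarCircle
  T5BergmanCoefficient T5SU11FibrationHaar T5SU11SphericalFunction T5SU11SphericalSymmetry
  T5SU11SphericalBounds T5SU11SphericalContinuous T5SU11JacobiLaplacePhase T5SU11JacobiPhaseLawRate
  T5SU11JacobiMeanPhaseRate T5SU11JacobiPhaseSecondOrder T5SU11JacobiPhaseLawRateOutside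
open scoped Real

section measure

variable [MeasurableSpace Circle] [BorelSpace Circle]

/-! ### The Jensen range `0 ≤ λ ≤ 2` -/

/-- **`(k − 2) m̂_k(λ)/(2π) ≤ 1`** for `k > 2`, `0 ≤ λ ≤ 2`. -/
theorem weight_ratio_le_one {k lam : ℝ} (hk : 2 < k) (h0 : 0 ≤ lam) (h2 : lam ≤ 2) :
    (k - 2) * (∫ g, (1 - ‖orbit g‖ ^ 2) ^ (k / 2) * sph lam g ∂(nu haarCircle)) / (2 * π) ≤ 1 := by
  have hr : 0 < k - 2 := by linarith
  rw [jacobi_eq_laplace_phase (by linarith) (by linarith) (by linarith),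
    show (k - 2) * (2 * π * ∫ s in Ioi (0 : ℝ), Real.exp (-((k - 2) * s)) * sphPhase lam s) / (2 * π)
      = (k - 2) * ∫ s in Ioi (0 : ℝ), Real.exp (-((k - 2) * s)) * sphPhase lam s by
        field_simp]
  have h := tail_le hk h0 h2 (le_refl (0 : ℝ))
  simp only [mul_zero, neg_zero, Real.exp_zero] at h
  calc (k - 2) * ∫ s in Ioi (0 : ℝ), Real.exp (-((k - 2) * s)) * sphPhase lam s
      ≤ (k - 2) * (1 / (k - 2)) := mul_le_mul_of_nonneg_left h hr.le
    _ = 1 := by field_simp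

/-- **`1 − c/(k − 2) ≤ (k − 2) m̂_k(λ)/(2π)`** for `k > 2`, `0 ≤ λ ≤ 2`, `c = λ(2 − λ)/2`. -/
theorem one_sub_le_weight_ratio {k lam : ℝ} (hk : 2 < k) (h0 : 0 ≤ lam) (h2 : lam ≤ 2) :
    1 - lam * (2 - lam) / 2 / (k - 2)
      ≤ (k - 2) * (∫ g, (1 - ‖orbit g‖ ^ 2) ^ (k / 2) * sph lam g ∂(nu haarCircle)) / (2 * π) := by
  have hr : 0 < k - 2 := by linarith
  rw [jacobi_eq_laplace_phase (by linarith) (by linarith) (by linarith),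
    show (k - 2) * (2 * π * ∫ s in Ioi (0 : ℝ), Real.exp (-((k - 2) * s)) * sphPhase lam s) / (2 * π)
      = (k - 2) * ∫ s in Ioi (0 : ℝ), Real.exp (-((k - 2) * s)) * sphPhase lam s by
        field_simp]
  have h := le_tail hk h0 h2 (le_refl (0 : ℝ))
  simp only [mul_zero, neg_zero, Real.exp_zero, one_mul, zero_add, mul_one_div] at h
  calc 1 - lam * (2 - lam) / 2 / (k - 2)
      = (k - 2) * ((1 - lam * (2 - lam) / 2 / (k - 2)) / (k - 2)) := by field_simp
    _ ≤ (k - 2) * ∫ s in Ioi (0 : ℝ), Real.exp (-((k - 2) * s)) * sphPhase lam s :=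
        mul_le_mul_of_nonneg_left h hr.le

/-- **The second-order bound**: `(k − 2) m̂_k(λ)/(2π) ≤ 1 − c/(k − 2) + c²/(k − 2)²` for `k > 2`, `0 ≤ λ ≤ 2`. -/
theorem weight_ratio_le_second_order {k lam : ℝ} (hk : 2 < k) (h0 : 0 ≤ lam) (h2 : lam ≤ 2) :
    (k - 2) * (∫ g, (1 - ‖orbit g‖ ^ 2) ^ (k / 2) * sph lam g ∂(nu haarCircle)) / (2 * π)
      ≤ 1 - lam * (2 - lam) / 2 / (k - 2) + (lam * (2 - lam) / 2) ^ 2 / (k - 2) ^ 2 := by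
  have hr : 0 < k - 2 := by linarith
  rw [jacobi_eq_laplace_phase (by linarith) (by linarith) (by linarith),
    show (k - 2) * (2 * π * ∫ s in Ioi (0 : ℝ), Real.exp (-((k - 2) * s)) * sphPhase lam s) / (2 * π)
      = (k - 2) * ∫ s in Ioi (0 : ℝ), Real.exp (-((k - 2) * s)) * sphPhase lam s by
        field_simp]
  have h := moment_phase_le' 0 hk h0 h2
  simp only [pow_zero, one_mul, Nat.factorial_zero, Nat.cast_one, zero_add, pow_one, Nat.factorial_one,
    Nat.factorial_two, Nat.cast_ofNat] at h
  calc (k - 2) * ∫ s in Ioi (0 : ℝ), Real.exp (-((k - 2) * s)) * sphPhase lam s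
      ≤ (k - 2) * (1 / (k - 2) - lam * (2 - lam) / 2 * 1 / (k - 2) ^ 2
          + (lam * (2 - lam) / 2) ^ 2 / 2 * 2 / (k - 2) ^ 3) := mul_le_mul_of_nonneg_left h hr.le
    _ = 1 - lam * (2 - lam) / 2 / (k - 2) + (lam * (2 - lam) / 2) ^ 2 / (k - 2) ^ 2 := by
        field_simp

/-- **The sharp first correction**: `(k − 2)(1 − (k − 2) m̂_k(λ)/(2π)) → c = λ(2 − λ)/2` as `k → ∞`, `0 ≤ λ ≤ 2`. -/
theorem tendsto_mul_one_sub_weight_ratio {lam : ℝ} (h0 : 0 ≤ lam) (h2 : lam ≤ 2) :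
    Tendsto (fun k : ℝ => (k - 2)
        * (1 - (k - 2) * (∫ g, (1 - ‖orbit g‖ ^ 2) ^ (k / 2) * sph lam g ∂(nu haarCircle)) / (2 * π)))
      atTop (𝓝 (lam * (2 - lam) / 2)) := by
  set c : ℝ := lam * (2 - lam) / 2 with hc
  have hε : Tendsto (fun k : ℝ => 1 / (k - 2)) atTop (𝓝 0) :=
    (tendsto_atTop_add_const_right atTop (-2) tendsto_id).const_div_atTop 1 |>.congr'
      (Filter.Eventually.of_forall fun k => by simp only [id, sub_eq_add_neg])
  have hU : Tendsto (fun k : ℝ => c - c ^ 2 * (1 / (k - 2))) atTop (𝓝 (c - c ^ 2 * 0)) :=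
    tendsto_const_nhds.sub (hε.const_mul _)
  rw [mul_zero, sub_zero] at hU
  refine tendsto_of_tendsto_of_tendsto_of_le_of_le' hU tendsto_const_nhds ?_ ?_
  · filter_upwards [eventually_gt_atTop (2 : ℝ)] with k hk
    have hr : 0 < k - 2 := by linarith
    have h := weight_ratio_le_second_order hk h0 h2
    rw [← hc] at h
    have e : c - c ^ 2 * (1 / (k - 2)) = (k - 2) * (1 - (1 - c / (k - 2) + c ^ 2 / (k - 2) ^ 2)) := by
      field_simp
      ring
    rw [e]
    exact mul_le_mul_of_nonneg_left (by linarith) hr.le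
  · filter_upwards [eventually_gt_atTop (2 : ℝ)] with k hk
    have hr : 0 < k - 2 := by linarith
    have h := one_sub_le_weight_ratio hk h0 h2
    rw [← hc] at h
    calc (k - 2) * (1 - (k - 2) * (∫ g, (1 - ‖orbit g‖ ^ 2) ^ (k / 2) * sph lam g ∂(nu haarCircle)) / (2 * π))
        ≤ (k - 2) * (1 - (1 - c / (k - 2))) := mul_le_mul_of_nonneg_left (by linarith) hr.le
      _ = c := by
          field_simp
          ring

/-! ### Outside the Jensen range -/

/-- **`1 ≤ (k − 2) m̂_k(λ)/(2π)`** for `λ ≥ 2`, `k > λ`. -/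
theorem one_le_weight_ratio_of_two_le {k lam : ℝ} (h2 : 2 ≤ lam) (hk : lam < k) :
    1 ≤ (k - 2) * (∫ g, (1 - ‖orbit g‖ ^ 2) ^ (k / 2) * sph lam g ∂(nu haarCircle)) / (2 * π) := by
  have hr : 0 < k - 2 := by linarith
  rw [jacobi_eq_laplace_phase (by linarith) hk (by linarith),
    show (k - 2) * (2 * π * ∫ s in Ioi (0 : ℝ), Real.exp (-((k - 2) * s)) * sphPhase lam s) / (2 * π)
      = (k - 2) * ∫ s in Ioi (0 : ℝ), Real.exp (-((k - 2) * s)) * sphPhase lam s by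
        field_simp]
  have h := le_tail_of_two_le h2 hk (le_refl (0 : ℝ))
  simp only [mul_zero, neg_zero, Real.exp_zero] at h
  calc (1 : ℝ) = (k - 2) * (1 / (k - 2)) := by field_simp
    _ ≤ (k - 2) * ∫ s in Ioi (0 : ℝ), Real.exp (-((k - 2) * s)) * sphPhase lam s :=
        mul_le_mul_of_nonneg_left h hr.le

/-- **`(k − 2) m̂_k(λ)/(2π) ≤ (k − 2)/(k − 2 − c')`** for `λ ≥ 2`, `k − 2 > c' = λ(λ − 2)/2`. -/
theorem weight_ratio_le_of_two_le {k lam : ℝ} (h2 : 2 ≤ lam) (hk : lam * (lam - 2) / 2 < k - 2) :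
    (k - 2) * (∫ g, (1 - ‖orbit g‖ ^ 2) ^ (k / 2) * sph lam g ∂(nu haarCircle)) / (2 * π)
      ≤ (k - 2) / (k - 2 - lam * (lam - 2) / 2) := by
  have hc0 : 0 ≤ lam * (lam - 2) / 2 := div_nonneg (mul_nonneg (by linarith) (by linarith)) (by norm_num)
  have hr : 0 < k - 2 := by linarith
  have hk' : lam < k := by nlinarith
  rw [jacobi_eq_laplace_phase (by linarith) hk' (by linarith),
    show (k - 2) * (2 * π * ∫ s in Ioi (0 : ℝ), Real.exp (-((k - 2) * s)) * sphPhase lam s) / (2 * π)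
      = (k - 2) * ∫ s in Ioi (0 : ℝ), Real.exp (-((k - 2) * s)) * sphPhase lam s by
        field_simp]
  have h := tail_le_of_two_le h2 hk (le_refl (0 : ℝ))
  simp only [mul_zero, neg_zero, Real.exp_zero] at h
  calc (k - 2) * ∫ s in Ioi (0 : ℝ), Real.exp (-((k - 2) * s)) * sphPhase lam s
      ≤ (k - 2) * (1 / (k - 2 - lam * (lam - 2) / 2)) := mul_le_mul_of_nonneg_left h hr.le
    _ = (k - 2) / (k - 2 - lam * (lam - 2) / 2) := by ring

/-- **`(k − 2) m̂_k(λ)/(2π) ≤ (k − 2)/(k − 2 − c')`** for `λ ≤ 0`, `k − 2 > c' = λ(λ − 2)/2` (by `φ_λ = φ_{2−λ}`). -/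
theorem weight_ratio_le_of_nonpos {k lam : ℝ} (h0 : lam ≤ 0) (hk : lam * (lam - 2) / 2 < k - 2) :
    (k - 2) * (∫ g, (1 - ‖orbit g‖ ^ 2) ^ (k / 2) * sph lam g ∂(nu haarCircle)) / (2 * π)
      ≤ (k - 2) / (k - 2 - lam * (lam - 2) / 2) := by
  have e : (2 - lam) * (2 - lam - 2) / 2 = lam * (lam - 2) / 2 := by ring
  have h := weight_ratio_le_of_two_le (lam := 2 - lam) (k := k) (by linarith) (by rw [e]; exact hk)
  rw [e] at h
  simp_rw [← sph_two_sub lam] at h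
  exact h

end measure

end Summit.Ventures.HodgeRepro2.T5SU11JacobiWeightRate
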